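import Summits.CriticalPhenomena.CardyFormulaZ2.Theses.CardyUSTContinuation
import Summits.CriticalPhenomena.CardyFormulaZ2.Theorems.CardyUSTContinuationUniformAnalyticExtensionNormalForm
import Literature.Probability.LatticeModels.FKTwoArcPartitionPolynomials
import HarnessLib

/-!
# Regime split of the crux `UniformAnalyticExtension` (stmt-CriticalPhenomena-6047, route
# `CardyUSTContinuation`) into GERMS: the percolation point `z = 1` and the open segment `(0,1)`

Strategist decomposition (crux-strategist seat `cstrat-stmt-CriticalPhenomena-6047-s1`).  By the landed
normal form (`Birth.normalForm_crux_iff_ratioBound`, p149263) the crux is equivalent to a δ-uniform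
bound on the junk-valued complex crossing ratio `f_δ = N_δ/Z_δ` (two-arc crossing / partition
polynomials of the jointly-wired self-dual FK model, `Literature.Probability.LatticeModels`) on a complex
neighbourhood of the whole segment `[t₁, 1]`, for every `t₁ ∈ (0,1)`.  Because `f_δ` is ONE global
rational function, a δ-uniform bound on a neighbourhood of the compact segment is the same as a
δ-uniform bound on a neighbourhood of EACH of its points (finite subcover + Lebesgue number; the
finitely many eventual-in-`δ` sets intersect).  This splits the crux LOSSLESSLY into two regimes:

* sub-crux `PercolationPointGerm` — a δ-uniform bound on a complex ball around `z = 1`, i.e. around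
  critical Bernoulli(1/2) bond percolation (`p = t/(1+t) = 1/2`, `q = t² = 1`): the endpoint where the
  base measure is i.i.d. (Harris–FKG, BK, RSW, arm events in the tree) and where the route's Vitali
  continuation has its accumulation point; on the real trace its Taylor data at `t = 1` are the joint
  cumulants of the crossing indicator with the loop count
  (`Birth.selfDual_mul_deriv_measureReal_eq_cov`, p171107);
* sub-crux `OpenSegmentGerms` — a δ-uniform bound on a complex ball around each INTERIOR point
  `t ∈ (0,1)` (`q = t² < 1`: no FK monotonicity; only the height-function FKG of the six-vertex
  representation, Duminil-Copin–Karrila–Manolescu–Oulamara 2020).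

Landed here: the compactness step `ratioBound_of_germs`, the glue
`UniformAnalyticExtension_of_germs : PercolationPointGerm → OpenSegmentGerms → crux`, the two converses
(each sub-crux follows from the crux: restriction of the normal-form bound to a ball inside the
thickening) and the certificate `germs_iff_crux` (the split loses nothing).
-/

noncomputable section

open Filter Topology Set Polynomial Metric
open Literature.Probability.LatticeModels
open Literature.Probability.RandomPlanarGeometry (ConformalRectangle)

namespace Summit.CriticalPhenomena.CardyFormulaZ2.Cruxes.UniformAnalyticExtension.Split

/-- **Germs ⇒ segment bound** (the compactness step).  If the complex crossing ratio is δ-uniformly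
bounded on a ball around `1` and on a ball around every `t ∈ (0,1)`, then for every `t₁ ∈ (0,1)` it is
δ-uniformly bounded on a complex neighbourhood of the whole segment `[t₁, 1]`: cover the compact segment
by finitely many of the balls, take a Lebesgue number `L` of that cover as the thickening radius and the
sum of the finitely many `|M_t|` as the bound; the finitely many eventual-in-`δ` sets intersect.
[folklore] -/
theorem ratioBound_of_germs
    (h1 : (∀ R : ConformalRectangle, ∃ ρ > (0:ℝ), ∃ M : ℝ, ∀ᶠ δ in 𝓝[>] (0:ℝ),
      ∀ z ∈ ball (1:ℂ) ρ,
        ‖aeval z (fkTwoArcCrossingPolynomial R δ ArcWiring.joint) /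
            aeval z (fkTwoArcPartitionPolynomials R δ ArcWiring.joint)‖ ≤ M))
    (h2 : (∀ R : ConformalRectangle, ∀ t ∈ Set.Ioo (0:ℝ) 1, ∃ ρ > (0:ℝ), ∃ M : ℝ, ∀ᶠ δ in 𝓝[>] (0:ℝ),
      ∀ z ∈ ball ((t : ℝ) : ℂ) ρ,
        ‖aeval z (fkTwoArcCrossingPolynomial R δ ArcWiring.joint) /
            aeval z (fkTwoArcPartitionPolynomials R δ ArcWiring.joint)‖ ≤ M)) :
    ∀ R : ConformalRectangle, ∀ t₁ ∈ Set.Ioo (0:ℝ) 1, ∃ ρ > (0:ℝ), ∃ M : ℝ, ∀ᶠ δ in 𝓝[>] (0:ℝ),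
      ∀ z ∈ thickening ρ (((↑) : ℝ → ℂ) '' Set.Icc t₁ 1),
        ‖aeval z (fkTwoArcCrossingPolynomial R δ ArcWiring.joint) /
            aeval z (fkTwoArcPartitionPolynomials R δ ArcWiring.joint)‖ ≤ M := by
  intro R t₁ ht₁
  -- a germ bound at every point of `[t₁, 1]`
  have hgerm : ∀ t ∈ Set.Icc t₁ 1, ∃ ρ > (0:ℝ), ∃ M : ℝ, ∀ᶠ δ in 𝓝[>] (0:ℝ),
      ∀ z ∈ ball ((t : ℝ) : ℂ) ρ,
        ‖aeval z (fkTwoArcCrossingPolynomial R δ ArcWiring.joint) /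
            aeval z (fkTwoArcPartitionPolynomials R δ ArcWiring.joint)‖ ≤ M := by
    intro t ht
    rcases eq_or_lt_of_le ht.2 with rfl | hlt
    · simpa using h1 R
    · exact h2 R t ⟨ht₁.1.trans_le ht.1, hlt⟩
  choose! ρ hρ M hM using hgerm
  set K : Set ℂ := ((↑) : ℝ → ℂ) '' Set.Icc t₁ 1 with hKdef
  have hK : IsCompact K := isCompact_Icc.image Complex.continuous_ofReal
  -- finite subcover of `K` by the balls `ball ↑t (ρ t)`, `t ∈ [t₁, 1]`
  obtain ⟨T, hTsub, hTfin, hTcov⟩ := hK.elim_finite_subcover_image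
    (b := Set.Icc t₁ 1) (c := fun t : ℝ => ball ((t : ℝ) : ℂ) (ρ t)) (fun t _ => isOpen_ball) (by
      rintro _ ⟨t, ht, rfl⟩
      exact mem_iUnion₂.mpr ⟨t, ht, mem_ball_self (hρ t ht)⟩)
  -- Lebesgue number of the finite cover
  obtain ⟨L, hL, hLeb⟩ := lebesgue_number_lemma_of_metric hK
    (c := fun t : T => ball (((t : ℝ) : ℝ) : ℂ) (ρ t)) (fun _ => isOpen_ball) (by
      intro x hx
      obtain ⟨t, htT, hxt⟩ := mem_iUnion₂.mp (hTcov hx)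
      exact mem_iUnion.mpr ⟨⟨t, htT⟩, hxt⟩)
  have hev : ∀ᶠ δ in 𝓝[>] (0:ℝ), ∀ t ∈ T, ∀ z ∈ ball ((t : ℝ) : ℂ) (ρ t),
      ‖aeval z (fkTwoArcCrossingPolynomial R δ ArcWiring.joint) /
          aeval z (fkTwoArcPartitionPolynomials R δ ArcWiring.joint)‖ ≤ M t :=
    (eventually_all_finite hTfin).mpr fun t htT => hM t (hTsub htT)
  refine ⟨L, hL, ∑ t ∈ hTfin.toFinset, |M t|, ?_⟩
  filter_upwards [hev] with δ hδ z hz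
  obtain ⟨x, hxK, hzx⟩ := mem_thickening_iff.mp hz
  obtain ⟨⟨t, htT⟩, hball⟩ := hLeb x hxK
  have hz' : z ∈ ball ((t : ℝ) : ℂ) (ρ t) := hball (mem_ball.mpr hzx)
  calc ‖aeval z (fkTwoArcCrossingPolynomial R δ ArcWiring.joint) /
          aeval z (fkTwoArcPartitionPolynomials R δ ArcWiring.joint)‖ ≤ M t := hδ t htT z hz'
    _ ≤ |M t| := le_abs_self _
    _ ≤ ∑ s ∈ hTfin.toFinset, |M s| :=
        Finset.single_le_sum (f := fun s => |M s|) (fun _ _ => abs_nonneg _)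
          (hTfin.mem_toFinset.mpr htT)

/-- **The glue of the split** (`UniformAnalyticExtension_of_subs`, bodies of the sub-cruxes
`PercolationPointGerm`, `OpenSegmentGerms` spelled out): the two germ sub-cruxes imply the crux
`UniformAnalyticExtension` — compactness (`ratioBound_of_germs`) followed by the landed normal form
`Birth.normalForm_crux_iff_ratioBound` (Riemann removable singularities, p145158/p145290/p149263).
[folklore] -/
theorem UniformAnalyticExtension_of_germs : (∀ R : Literature.Probability.RandomPlanarGeometry.ConformalRectangle, ∃ ρ > (0:ℝ), ∃ M : ℝ, ∀ᶠ δ in 𝓝[>] (0:ℝ), ∀ z ∈ Metric.ball (1:ℂ) ρ, ‖Polynomial.aeval z (Literature.Probability.LatticeModels.fkTwoArcCrossingPolynomial R δ Literature.Probability.LatticeModels.ArcWiring.joint) / Polynomial.aeval z (Literature.Probability.LatticeModels.fkTwoArcPartitionPolynomials R δ Literature.Probability.LatticeModels.ArcWiring.joint)‖ ≤ M) → (∀ R : Literature.Probability.RandomPlanarGeometry.ConformalRectangle, ∀ t ∈ Set.Ioo (0:ℝ) 1, ∃ ρ > (0:ℝ), ∃ M : ℝ, ∀ᶠ δ in 𝓝[>]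 (0:ℝ), ∀ z ∈ Metric.ball ((t : ℝ) : ℂ) ρ, ‖Polynomial.aeval z (Literature.Probability.LatticeModels.fkTwoArcCrossingPolynomial R δ Literature.Probability.LatticeModels.ArcWiring.joint) / Polynomial.aeval z (Literature.Probability.LatticeModels.fkTwoArcPartitionPolynomials R δ Literature.Probability.LatticeModels.ArcWiring.joint)‖ ≤ M) → Summit.CriticalPhenomena.CardyFormulaZ2.Theses.CardyUSTContinuation.UniformAnalyticExtension :=
  fun h1 h2 => Birth.normalForm_crux_iff_ratioBound.mpr (ratioBound_of_germs h1 h2)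

/-- **Crux ⇒ sub-crux `PercolationPointGerm`**: the normal-form bound for `t₁ = 1/2` restricted to the
ball `ball 1 ρ ⊆ U_ρ([1/2, 1])`. [folklore] -/
theorem percolationPointGerm_of_crux (h : Summit.CriticalPhenomena.CardyFormulaZ2.Theses.CardyUSTContinuation.UniformAnalyticExtension) :
    (∀ R : ConformalRectangle, ∃ ρ > (0:ℝ), ∃ M : ℝ, ∀ᶠ δ in 𝓝[>] (0:ℝ),
      ∀ z ∈ ball (1:ℂ) ρ,
        ‖aeval z (fkTwoArcCrossingPolynomial R δ ArcWiring.joint) /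
            aeval z (fkTwoArcPartitionPolynomials R δ ArcWiring.joint)‖ ≤ M) := by
  intro R
  obtain ⟨ρ, hρ, M, hev⟩ :=
    Birth.normalForm_ratioBound_of_crux h R (1/2) ⟨by norm_num, by norm_num⟩
  refine ⟨ρ, hρ, M, ?_⟩
  filter_upwards [hev] with δ hδ z hz
  have h1K : (1:ℂ) ∈ ((↑) : ℝ → ℂ) '' Set.Icc (1/2:ℝ) 1 := ⟨1, ⟨by norm_num, le_rfl⟩, by simp⟩
  exact hδ z (ball_subset_thickening h1K ρ hz)

/-- **Crux ⇒ sub-crux `OpenSegmentGerms`**: the normal-form bound for `t₁ = t` restricted to the ball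
`ball ↑t ρ ⊆ U_ρ([t, 1])`. [folklore] -/
theorem openSegmentGerms_of_crux (h : Summit.CriticalPhenomena.CardyFormulaZ2.Theses.CardyUSTContinuation.UniformAnalyticExtension) :
    (∀ R : ConformalRectangle, ∀ t ∈ Set.Ioo (0:ℝ) 1, ∃ ρ > (0:ℝ), ∃ M : ℝ, ∀ᶠ δ in 𝓝[>] (0:ℝ),
      ∀ z ∈ ball ((t : ℝ) : ℂ) ρ,
        ‖aeval z (fkTwoArcCrossingPolynomial R δ ArcWiring.joint) /
            aeval z (fkTwoArcPartitionPolynomials R δ ArcWiring.joint)‖ ≤ M) := by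
  intro R t ht
  obtain ⟨ρ, hρ, M, hev⟩ := Birth.normalForm_ratioBound_of_crux h R t ⟨ht.1, ht.2⟩
  refine ⟨ρ, hρ, M, ?_⟩
  filter_upwards [hev] with δ hδ z hz
  have htK : ((t : ℝ) : ℂ) ∈ ((↑) : ℝ → ℂ) '' Set.Icc t 1 := ⟨t, ⟨le_rfl, ht.2.le⟩, rfl⟩
  exact hδ z (ball_subset_thickening htK ρ hz)

/-- **Certificate: the split is lossless** — the conjunction of the two germ sub-cruxes is
equivalent to the crux. [folklore] -/
theorem germs_iff_crux :
    ((∀ R : ConformalRectangle, ∃ ρ > (0:ℝ), ∃ M : ℝ, ∀ᶠ δ in 𝓝[>] (0:ℝ),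
      ∀ z ∈ ball (1:ℂ) ρ,
        ‖aeval z (fkTwoArcCrossingPolynomial R δ ArcWiring.joint) /
            aeval z (fkTwoArcPartitionPolynomials R δ ArcWiring.joint)‖ ≤ M) ∧
      (∀ R : ConformalRectangle, ∀ t ∈ Set.Ioo (0:ℝ) 1, ∃ ρ > (0:ℝ), ∃ M : ℝ, ∀ᶠ δ in 𝓝[>] (0:ℝ),
      ∀ z ∈ ball ((t : ℝ) : ℂ) ρ,
        ‖aeval z (fkTwoArcCrossingPolynomial R δ ArcWiring.joint) /
            aeval z (fkTwoArcPartitionPolynomials R δ ArcWiring.joint)‖ ≤ M)) ↔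
      Summit.CriticalPhenomena.CardyFormulaZ2.Theses.CardyUSTContinuation.UniformAnalyticExtension :=
  ⟨fun h => UniformAnalyticExtension_of_germs h.1 h.2,
    fun h => ⟨percolationPointGerm_of_crux h, openSegmentGerms_of_crux h⟩⟩

end Summit.CriticalPhenomena.CardyFormulaZ2.Cruxes.UniformAnalyticExtension.Split
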